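import Literature.Analysis.FluidPDE.ForwardDSSPressureKernel
import Literature.Analysis.FluidPDE.ForwardDSSPressureLocalTerm
import Literature.Analysis.FluidPDE.ForwardDSSMollifiedSchemeEnergy
import Literature.Analysis.FluidPDE.NormalisedPressureCompactSupport
import HarnessLib

/-!
# Forward DSS solutions: the pressure bound of Bradshaw–Tsai 2019, p. 10, from the formula (3.8)

Analysis/FluidPDE proof file (theorems only) under the named fact
`Literature.Analysis.FluidPDE.bradshawTsai2019_apriori_3_12` (`ForwardDSSMollifiedScheme.lean`:
the a priori estimate (3.12) with the pressure bound of Bradshaw–Tsai, Analysis & PDE 12 (2019)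
= arXiv:1801.08060, §3, Prop. 3.1). The printed proof controls the pressure of the mollified
approximants through the formula of p. 9,

> (3.8) `π_ε(x,t) = −⅓[(η_{ε√t}*v_ε)·v_ε](x,t) + lim_{δ→0}∫_{|y|>δ} Kᵢⱼ(x−y)(η_{ε√t}*v_ε)ᵢ(y,t)(v_ε)ⱼ(y,t) dy`,

in three displayed bounds (p. 9 for the local term, p. 10 for `π_near` by "the Calderon-Zygmund
theory" and for `π_far` by the annuli `A_k`), closing with

> "After using Hölder's inequality, (3.11), the above bounds, and `α^{3/2} ≤ α + α³` for `α > 0`,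
> it is clear that `∫₀ᵗ‖π_ε(·,s)‖^{3/2}_{L^{3/2}(B_λ)} ds + ∫₀ᵗ∫2π_ε(v_ε·∇φ) dx ds
> ≤ C(λ,γ,η)∫₀ᵗ(α̃_ε(s)³ + α̃_ε(s)) ds + γ∫₀ᵗ∫|∇v_ε|²φ dx ds`." (p. 10)

This file **proves** the first half of this display — the bound for
`∫₀ᵗ‖π_ε(·,s)‖^{3/2}_{L^{3/2}(B_λ)} ds` — for every field of the kind the estimates are about,
*given the formula (3.8) almost everywhere* (main theorem
`BradshawTsai2019.exists_setLIntegral_cylinder_pressure_rpow_le`): for `λ > 1`, a mollifier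
`η ∈ C^∞` (`η ≥ 0`, `∫η = 1`, `η = 0` off `B_ρ`), a `C¹` cut-off `χ` (`φ = χ²`; `|χ| ≤ 1`, `‖Dχ‖ ≤ M`,
`χ = 0` off `B_R`, `R ≤ λ`, `χ = 1` on `B₁`), a smooth cut-off `ζ` replacing the printed indicator
`χ_{B_{λ²}}` of the near/far splitting (`|ζ| ≤ 1`, `ζ = 1` on `B_{λ²}`, `ζ = 0` off `B_{λ³}`) and
`γ ∈ (0, ∞)`, there is ONE constant `C < ∞` such that for every `ε > 0` with `ερ ≤ λ − 1`, every
`λ`-DSS field `w` continuous on the open slab with smooth slices and continuous slice gradients,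
and every `ϖ` satisfying (3.8) a.e. on the slab (the bilinear principal value
`HasPressureFormPV` of `ForwardDSSPressureKernel`),
`∫∫_{(0,t)×B_λ}|ϖ|^{3/2} ≤ C∫₀ᵗ(α̃³ + α̃) + γ∫∫_{(0,t)×ℝ³}χ²|Dw|²`, `0 < t ≤ 1`. The constant is
uniform in `ε`, `w`, `ϖ` — the order of quantifiers `∃ C, ∀ w` that (3.12) needs ("`C(λ,γ,η)`");
to this end the Gagliardo–Nirenberg-in-time step of the sibling `ForwardDSSLocalEnergyCubic` is
re-derived with the constant exposed (`exists_setLIntegral_unitCylinder_cube_le`, from the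
accepted `lintegral_enorm_cutoff_smul_rpow_three_le` whose constant is already uniform).

Steps (all proved):

* `setLIntegral_ball_pow_drift_sq_add_sq_le`, `lintegral_far_slice_le` — the growth hypothesis of
  the far-field bound of `ForwardDSSPressureKernel` from (3.6) and (3.10):
  `∫_{B_{λᵏ⁺¹}}(|η_{ε√s}*w|² + |w|²)(s) ≤ λᵏ⁺¹(λ+1)α̃(s)`, whence
  `∫_{|y|≥λ²}|ΣKᵢⱼ(x−y)bᵢwⱼ| ≤ farConst(λ)(λ+1)α̃(s)` for `x ∈ B_λ` ("`|π_far(x,t)| ≤ C(λ)α̃_ε(t)`");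
* `lintegral_pvForm_slice_le` — the near field on a slice:
  `∫|pvForm(ζb(s), ζw(s))|^{3/2} ≤ 2·nearConst·∫_{B_{λ⁴}}|w(s)|³` (the Calderón–Zygmund bound of
  `ForwardDSSPressureKernel` over the tree's proved `stein1970_normalisedPressure_Lp_bound_holds`,
  `|ζ| ≤ 1`, (3.10) with `q = 3`);
* `setLIntegral_ball_pressure_slice_le` — on a slice where (3.8) holds a.e.:
  `∫_{B_λ}|ϖ(s)|^{3/2} ≤ 4(∫_{B_λ}|b|³ + ∫_{B_λ}|w|³ + 2·nearConst∫_{B_{λ⁴}}|w|³ + |B_λ|(farConst(λ)(λ+1)α̃(s))^{3/2})`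
  (the splitting `HasPressureFormPV.eq_add_far`, `|⟨b,w⟩|^{3/2} ≤ |b|³ + |w|³`);
* the main theorem: the formula a.e. on the slab gives it a.e. in `x` for a.e. `s` (Fubini for
  null sets); integrate the slice bound over `(0,t)` (Tonelli in the inequality form where the
  integrand is not known to be measurable, as an equality for the continuous `|w|³`), send the
  cubic masses on `B_λ, B_{λ²}, B_{λ⁴}` to the unit cylinder by (3.6)
  (`setLIntegral_cylinder_pow_enorm_cube_le`), apply Gagliardo–Nirenberg in time with the weight
  `γ/K_c`, and use `α̃^{3/2} ≤ α̃ + α̃³`.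

What is *not* done here: the derivation of (3.8) itself for members of
`BradshawTsai2019.IsMollifiedApproximant` (from the distributional equation (3.5) and the `L²`
classes recorded there), and the pressure term `∫∫2π_ε(v_ε·∇φ)` of (3.7), which the consumer
bounds by Young from this file and the cubic estimate.

## Mathlib / tree search

Reused, nothing redefined: `mollifiedDrift`, `scaledMollifier`, the (3.10) bound
`setLIntegral_ball_pow_enorm_mollifiedDrift_rpow_le`, `isDiscretelySelfSimilar_pow`
(`ForwardDSSMollifiedDrift`, `ForwardDSSExtension`); `contDiff_mollifiedDrift_slice`
(`ForwardDSSMollifiedSchemeEnergy`); the scaling laws `setLIntegral_ball_enorm_sq_le_supBallEnergy`,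
`setLIntegral_cylinder_enorm_cube_le_of_dss` (`ForwardDSSLocalEnergyScaling`); the Tonelli and
measurability helpers `setLIntegral_cylinder_le_iterate/_eq_iterate`,
`aestronglyMeasurable_restrict_of_continuousOn`, `measurable_supBallEnergy`, `volume_restrict_real_prod`
(`ForwardDSSLocalEnergyCubic`); `lintegral_enorm_cutoff_smul_rpow_three_le`,
`rpow_three_halves_le_self_add_pow_three` (`ForwardDSSLocalEnergySobolev`);
`mul_rpow_three_halves_le_add` (`ForwardDSSPressureLocalTerm`); `pvForm`, `hasPressureFormPV_pvForm`,
`lintegral_enorm_pvForm_rpow_le`, `lintegral_far_pressureForm_le`, `HasPressureFormPV.eq_add_far`,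
`enorm_integral_far_le`, `rpow_three_halves_add_four_le`, `nearConst`, `farConst`
(`ForwardDSSPressureKernel`); `stein1970_normalisedPressure_Lp_bound_holds`,
`aestronglyMeasurable_normalisedPressure`, `lintegral_enorm_sq_lt_top_of_hasCompactSupport`
(`NormalisedPressureLpBoundProofs`, `NormalisedPressureL2Bound`, `NormalisedPressureCompactSupport`).
Mathlib: `Measure.ae_ae_of_ae_prod`, `AEMeasurable.lintegral_prod_right'`, `ENNReal.mul_div_cancel`.

## References

* Z. Bradshaw, T.-P. Tsai, *Discretely self-similar solutions to the Navier–Stokes equations with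
  data in `L²_loc` satisfying the local energy inequality*, Analysis & PDE 12 (2019) 1943–1962 =
  arXiv:1801.08060, §3, proof of Prop. 3.1: (3.8), the bounds for the local term (p. 9), `π_near`,
  `π_far` and the closing display (p. 10) [BradshawTsai2019].
* E. M. Stein, *Singular integrals and differentiability properties of functions* (1970), Ch. II
  §4.2 Thm 3 [Stein1971].
-/

noncomputable section

open MeasureTheory Set Function Filter Topology TopologicalSpace Metric Module
open scoped NNReal ENNReal RealInnerProductSpace ContDiff Convolution

namespace Literature.Analysis.FluidPDE

/-- Local notation for physical space `ℝ³ = EuclideanSpace ℝ (Fin 3)`. -/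
local notation "ℝ³" => EuclideanSpace ℝ (Fin 3)

namespace BradshawTsai2019

/-! ## The cubic mass on the unit cylinder, with a constant uniform in the field -/

/-- **Gagliardo–Nirenberg, integrated in time, uniform constant** (the sibling
`setLIntegral_unitCylinder_cube_le` of `ForwardDSSLocalEnergyCubic` with the quantifiers in the
order `∃ C, ∀ w`: the constant depends on `λ`, the cut-off and `γ` only — as (3.12) requires,
"`C(λ, η, γ)`"). For `λ > 1`, a `C¹` cut-off `χ` (`|χ| ≤ 1`, `‖Dχ‖ ≤ M`, `χ = 0` off `B_R`, `R ≤ λ`,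
`χ = 1` on `B₁`) and `γ ∈ (0, ∞)` there is `C < ∞` such that for every `λ`-DSS field `w` with
`C¹` slices whose slice gradients are continuous on the open slab, and every `t > 0`,
`∫∫_{(0,t)×B₁} |w|³ ≤ C ∫₀ᵗ (α̃³ + α̃) + γ ∫∫_{(0,t)×ℝ³} χ²|Dw|²`.
[cite: BradshawTsai2019, §3 p. 9 (Gagliardo–Nirenberg step)] -/
theorem exists_setLIntegral_unitCylinder_cube_le {c : ℝ} (hc : 1 < c) {χ : ℝ³ → ℝ}
    (hχ : ContDiff ℝ 1 χ) (hχ1 : ∀ x, |χ x| ≤ 1) {M : ℝ} (hM : ∀ x, ‖fderiv ℝ χ x‖ ≤ M)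
    {R : ℝ} (hRc : R ≤ c) (hχc : ∀ x, R ≤ ‖x‖ → χ x = 0) (hχB : ∀ x ∈ ball (0 : ℝ³) 1, χ x = 1)
    {γ : ℝ≥0∞} (hγ0 : γ ≠ 0) (hγt : γ ≠ ⊤) :
    ∃ C : ℝ≥0∞, C ≠ ⊤ ∧ ∀ w : ℝ → ℝ³ → ℝ³, IsDiscretelySelfSimilar c w →
      (∀ s, 0 < s → ContDiff ℝ 1 (w s)) →
      ContinuousOn (fun z : ℝ × ℝ³ => fderiv ℝ (w z.1) z.2) (Ioi (0 : ℝ) ×ˢ (univ : Set ℝ³)) →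
      ∀ t : ℝ, 0 < t →
        ∫⁻ z in Ioo (0 : ℝ) t ×ˢ ball (0 : ℝ³) 1, ‖w z.1 z.2‖ₑ ^ (3 : ℝ) ≤
          C * (∫⁻ s in Ioo (0 : ℝ) t, (supBallEnergy w s ^ 3 + supBallEnergy w s)) +
            γ * ∫⁻ z in Ioo (0 : ℝ) t ×ˢ (univ : Set ℝ³),
              ENNReal.ofReal (χ z.2 ^ 2 * frobeniusNormSq (fderiv ℝ (w z.1) z.2)) := by
  have hc0 : 0 < c := zero_lt_one.trans hc
  obtain ⟨C₀, hC₀t, hGN⟩ := lintegral_enorm_cutoff_smul_rpow_three_le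
    (E := ℝ³) (F' := ℝ³) finrank_euclideanSpace_fin hχ hχ1 hM (R := R) hχc hγ0 hγt
  set K : ℝ≥0∞ := ENNReal.ofReal c ^ 3 with hK
  have hK1 : 1 ≤ ENNReal.ofReal c := by
    rw [← ENNReal.ofReal_one]; exact ENNReal.ofReal_le_ofReal hc.le
  refine ⟨C₀ * K, ENNReal.mul_ne_top hC₀t (ENNReal.pow_ne_top ENNReal.ofReal_ne_top),
    fun w hw hws hHm t ht => ?_⟩
  -- the slice bound
  have hslice : ∀ s ∈ Ioo (0 : ℝ) t,
      ∫⁻ x in ball (0 : ℝ³) 1, ‖w s x‖ₑ ^ (3 : ℝ) ≤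
        C₀ * K * (supBallEnergy w s ^ 3 + supBallEnergy w s) +
          γ * ∫⁻ x, ENNReal.ofReal (χ x ^ 2 * frobeniusNormSq (fderiv ℝ (w s) x)) := by
    intro s hs
    have h1 : ∫⁻ x in ball (0 : ℝ³) 1, ‖w s x‖ₑ ^ (3 : ℝ) ≤ ∫⁻ x, ‖χ x • w s x‖ₑ ^ (3 : ℝ) := by
      calc ∫⁻ x in ball (0 : ℝ³) 1, ‖w s x‖ₑ ^ (3 : ℝ)
          = ∫⁻ x in ball (0 : ℝ³) 1, ‖χ x • w s x‖ₑ ^ (3 : ℝ) :=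
            setLIntegral_congr_fun measurableSet_ball fun x hx => by rw [hχB x hx, one_smul]
        _ ≤ ∫⁻ x, ‖χ x • w s x‖ₑ ^ (3 : ℝ) := setLIntegral_le_lintegral _ _
    have h2 := hGN (w s) (hws s hs.1)
    set A : ℝ≥0∞ := ∫⁻ x in ball (0 : ℝ³) R, ‖w s x‖ₑ ^ 2 with hA
    have hAle : A ≤ ENNReal.ofReal c * supBallEnergy w s :=
      (lintegral_mono_set (ball_subset_ball hRc)).trans
        (setLIntegral_ball_enorm_sq_le_supBallEnergy hc hw hs.1)
    have hA3 : A ^ 3 + A ≤ K * (supBallEnergy w s ^ 3 + supBallEnergy w s) := by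
      rw [mul_add]
      refine add_le_add ?_ ?_
      · calc A ^ 3 ≤ (ENNReal.ofReal c * supBallEnergy w s) ^ 3 := pow_le_pow_left' hAle 3
          _ = K * supBallEnergy w s ^ 3 := by rw [hK, mul_pow]
      · calc A ≤ ENNReal.ofReal c * supBallEnergy w s := hAle
          _ ≤ K * supBallEnergy w s := by
              refine mul_le_mul' ?_ le_rfl
              calc ENNReal.ofReal c = ENNReal.ofReal c ^ 1 := (pow_one _).symm
                _ ≤ ENNReal.ofReal c ^ 3 := pow_le_pow_right' hK1 (by norm_num)
    calc ∫⁻ x in ball (0 : ℝ³) 1, ‖w s x‖ₑ ^ (3 : ℝ)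
        ≤ ∫⁻ x, ‖χ x • w s x‖ₑ ^ (3 : ℝ) := h1
      _ ≤ C₀ * (A ^ 3 + A) +
            γ * ∫⁻ x, ENNReal.ofReal (χ x ^ 2 * frobeniusNormSq (fderiv ℝ (w s) x)) := h2
      _ ≤ C₀ * (K * (supBallEnergy w s ^ 3 + supBallEnergy w s)) +
            γ * ∫⁻ x, ENNReal.ofReal (χ x ^ 2 * frobeniusNormSq (fderiv ℝ (w s) x)) :=
          add_le_add (mul_le_mul' le_rfl hA3) le_rfl
      _ = _ := by rw [mul_assoc]
  -- measurability of the two right-hand integrands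
  have hmeas0 : Measurable fun s => supBallEnergy w s ^ 3 + supBallEnergy w s :=
    ((measurable_supBallEnergy w).pow_const 3).add (measurable_supBallEnergy w)
  have hmeas1 : Measurable fun s => C₀ * K * (supBallEnergy w s ^ 3 + supBallEnergy w s) :=
    hmeas0.const_mul _
  have hmeas2 : AEMeasurable (fun z : ℝ × ℝ³ =>
      ENNReal.ofReal (χ z.2 ^ 2 * frobeniusNormSq (fderiv ℝ (w z.1) z.2)))
      (volume.restrict (Ioo (0 : ℝ) t ×ˢ (univ : Set ℝ³))) := by
    have hc2 : ContinuousOn (fun z : ℝ × ℝ³ => χ z.2 ^ 2 * frobeniusNormSq (fderiv ℝ (w z.1) z.2))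
        (Ioi (0 : ℝ) ×ˢ (univ : Set ℝ³)) :=
      ((hχ.continuous.comp continuous_snd).pow 2).continuousOn.mul
        (LerayHopfProofs.continuous_frobeniusNormSq.comp_continuousOn hHm)
    exact (aestronglyMeasurable_restrict_of_continuousOn hc2 t
      MeasurableSet.univ).aemeasurable.ennreal_ofReal
  -- integrate the slice bound over `(0, t)`
  calc ∫⁻ z in Ioo (0 : ℝ) t ×ˢ ball (0 : ℝ³) 1, ‖w z.1 z.2‖ₑ ^ (3 : ℝ)
      ≤ ∫⁻ s in Ioo (0 : ℝ) t, ∫⁻ x in ball (0 : ℝ³) 1, ‖w s x‖ₑ ^ (3 : ℝ) :=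
        setLIntegral_cylinder_le_iterate _ t _
    _ ≤ ∫⁻ s in Ioo (0 : ℝ) t, (C₀ * K * (supBallEnergy w s ^ 3 + supBallEnergy w s) +
          γ * ∫⁻ x, ENNReal.ofReal (χ x ^ 2 * frobeniusNormSq (fderiv ℝ (w s) x))) :=
        setLIntegral_mono' measurableSet_Ioo hslice
    _ = C₀ * K * (∫⁻ s in Ioo (0 : ℝ) t, (supBallEnergy w s ^ 3 + supBallEnergy w s)) +
          γ * ∫⁻ s in Ioo (0 : ℝ) t, ∫⁻ x,
            ENNReal.ofReal (χ x ^ 2 * frobeniusNormSq (fderiv ℝ (w s) x)) := by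
        rw [lintegral_add_left hmeas1, lintegral_const_mul _ hmeas0, lintegral_const_mul' _ _ hγt]
    _ = C₀ * K * (∫⁻ s in Ioo (0 : ℝ) t, (supBallEnergy w s ^ 3 + supBallEnergy w s)) +
          γ * ∫⁻ z in Ioo (0 : ℝ) t ×ˢ (univ : Set ℝ³),
            ENNReal.ofReal (χ z.2 ^ 2 * frobeniusNormSq (fderiv ℝ (w z.1) z.2)) := by
        rw [setLIntegral_cylinder_eq_iterate hmeas2]
        simp only [Measure.restrict_univ]

/-- **The cubic mass on a larger cylinder**: `∫∫_{(0,t)×B_{λᵏ}} |w|³ ≤ λ²ᵏ ∫∫_{(0,t)×B₁} |w|³`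
for a `λ`-DSS field ((3.6) with `q = 3` along the orbit; the accepted
`setLIntegral_cylinder_enorm_cube_le_of_dss` for the factor `λᵏ`).
[cite: BradshawTsai2019, §3 (3.6)] -/
theorem setLIntegral_cylinder_pow_enorm_cube_le {c : ℝ} (hc : 1 < c) {w : ℝ → ℝ³ → ℝ³}
    (hw : IsDiscretelySelfSimilar c w) (k : ℕ) {t : ℝ} (ht : 0 < t) :
    ∫⁻ z in Ioo (0 : ℝ) t ×ˢ ball (0 : ℝ³) (c ^ k), ‖w z.1 z.2‖ₑ ^ (3 : ℝ) ≤
      ENNReal.ofReal (c ^ (2 * k)) *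
        ∫⁻ z in Ioo (0 : ℝ) t ×ˢ ball (0 : ℝ³) 1, ‖w z.1 z.2‖ₑ ^ (3 : ℝ) := by
  rcases Nat.eq_zero_or_pos k with rfl | hk
  · simp
  · have hck : 1 < c ^ k := one_lt_pow₀ hc hk.ne'
    have h := setLIntegral_cylinder_enorm_cube_le_of_dss hck (isDiscretelySelfSimilar_pow hw k) ht
    rwa [← pow_mul, mul_comm k 2] at h

/-! ## Slices of the drift -/

section DriftSlices

variable {η : ℝ³ → ℝ} {ρ ε : ℝ} {w : ℝ → ℝ³ → ℝ³}

/-- Slices of the drift are continuous (for a continuous kernel). [folklore] -/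
theorem continuous_mollifiedDrift_slice (hη : Continuous η) (hηρ : ∀ y, ρ ≤ ‖y‖ → η y = 0)
    (hε : 0 < ε) {t : ℝ} (ht : 0 < t) (hwt : Continuous (w t)) :
    Continuous (mollifiedDrift η ε w t) := by
  have hδ : 0 < ε * Real.sqrt t := mul_pos hε (Real.sqrt_pos.2 ht)
  have h : mollifiedDrift η ε w t =
      (scaledMollifier η (ε * Real.sqrt t) ⋆[ContinuousLinearMap.lsmul ℝ ℝ, volume] w t) :=
    rfl
  rw [h]
  exact (hasCompactSupport_scaledMollifier hηρ hδ).continuous_convolution_left _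
    (continuous_scaledMollifier hη _) (hwt.locallyIntegrable)

end DriftSlices

/-! ## The far field on a slice -/

section Slices

variable {c : ℝ} {η : ℝ³ → ℝ} {ρ ε : ℝ} {w : ℝ → ℝ³ → ℝ³}

/-- **Linear growth of the local energies along the scaling orbit** (Bradshaw–Tsai 2019, p. 10,
the re-scaling inside the bound for `π_far`: "`≤ C(λ)Σ λ^{−2k}‖v_ε(tλ^{−2k})‖²_{L²(B_{λ²})} ≤ C(λ)α̃_ε(t)`",
with (3.6) and (3.10)): for `0 < s ≤ 1`, `ερ ≤ λ − 1` and every `k`,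
`∫_{B_{λᵏ⁺¹}} (|η_{ε√s} * w(s)|² + |w(s)|²) ≤ λᵏ⁺¹ (λ + 1) α̃(s)`. [cite: BradshawTsai2019, §3 proof of Prop 3.1 (bound for π_far, p. 10)] -/
theorem setLIntegral_ball_pow_drift_sq_add_sq_le (hc : 1 < c) (hηc : Continuous η)
    (hη0 : ∀ y, 0 ≤ η y) (hη1 : ∫ y, η y = 1) (hηρ : ∀ y, ρ ≤ ‖y‖ → η y = 0) (hε : 0 < ε)
    (hερ : ε * ρ ≤ c - 1) (hw : IsDiscretelySelfSimilar c w) {s : ℝ} (hs0 : 0 < s) (hs1 : s ≤ 1)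
    (hws : Continuous (w s)) (k : ℕ) :
    ∫⁻ y in ball (0 : ℝ³) (c ^ (k + 1)),
        (‖mollifiedDrift η ε w s y‖ₑ ^ 2 + ‖w s y‖ₑ ^ 2) ≤
      ENNReal.ofReal (c ^ (k + 1)) * ((ENNReal.ofReal c + 1) * supBallEnergy w s) := by
  have hc0 : 0 < c := zero_lt_one.trans hc
  have hbm : Measurable fun y => ‖mollifiedDrift η ε w s y‖ₑ ^ 2 :=
    (continuous_mollifiedDrift_slice hηc hηρ hε hs0 hws).enorm.measurable.pow_const _
  rw [lintegral_add_left hbm]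
  -- the drift: (3.10) with `q = 2`, then (3.6)
  have h1 : ∫⁻ y in ball (0 : ℝ³) (c ^ (k + 1)), ‖mollifiedDrift η ε w s y‖ₑ ^ 2 ≤
      ENNReal.ofReal (c ^ (k + 2)) * supBallEnergy w s := by
    have h := setLIntegral_ball_pow_enorm_mollifiedDrift_rpow_le (F := ℝ³) hc hηc hη0 hη1 hηρ
      hε hερ hs0 hs1 hws.aestronglyMeasurable (q := 2) (by norm_num) (k + 1)
    simp only [ENNReal.rpow_two] at h
    refine h.trans ?_
    have hck : 1 < c ^ (k + 2) := one_lt_pow₀ hc (by omega)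
    exact setLIntegral_ball_enorm_sq_le_supBallEnergy hck (isDiscretelySelfSimilar_pow hw _) hs0
  -- the field: (3.6)
  have h2 : ∫⁻ y in ball (0 : ℝ³) (c ^ (k + 1)), ‖w s y‖ₑ ^ 2 ≤
      ENNReal.ofReal (c ^ (k + 1)) * supBallEnergy w s := by
    have hck : 1 < c ^ (k + 1) := one_lt_pow₀ hc (by omega)
    exact setLIntegral_ball_enorm_sq_le_supBallEnergy hck (isDiscretelySelfSimilar_pow hw _) hs0
  calc (∫⁻ y in ball (0 : ℝ³) (c ^ (k + 1)), ‖mollifiedDrift η ε w s y‖ₑ ^ 2) +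
        ∫⁻ y in ball (0 : ℝ³) (c ^ (k + 1)), ‖w s y‖ₑ ^ 2
      ≤ ENNReal.ofReal (c ^ (k + 2)) * supBallEnergy w s +
          ENNReal.ofReal (c ^ (k + 1)) * supBallEnergy w s := add_le_add h1 h2
    _ = ENNReal.ofReal (c ^ (k + 1)) * ((ENNReal.ofReal c + 1) * supBallEnergy w s) := by
        rw [pow_succ c (k + 1), ENNReal.ofReal_mul (by positivity)]
        ring

/-- **The far-field tail on a slice** (Bradshaw–Tsai 2019, p. 10: "`|π_far(x,t)| ≤ … ≤ C(λ)α̃_ε(t)`"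
for `x ∈ B_λ`): `∫_{|y|≥λ²} |Σ Kᵢⱼ(x−y)(η_{ε√s}*w)ᵢ(y,s)wⱼ(y,s)| dy ≤ farConst(λ)(λ+1) α̃(s)`,
`0 < s ≤ 1`. [cite: BradshawTsai2019, §3 proof of Prop 3.1 (bound for π_far, p. 10)] -/
theorem lintegral_far_slice_le (hc : 1 < c) (hηc : Continuous η) (hη0 : ∀ y, 0 ≤ η y)
    (hη1 : ∫ y, η y = 1) (hηρ : ∀ y, ρ ≤ ‖y‖ → η y = 0) (hε : 0 < ε) (hερ : ε * ρ ≤ c - 1)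
    (hw : IsDiscretelySelfSimilar c w) {s : ℝ} (hs0 : 0 < s) (hs1 : s ≤ 1)
    (hws : Continuous (w s)) {x : ℝ³} (hx : x ∈ ball (0 : ℝ³) c) :
    ∫⁻ y in (ball (0 : ℝ³) (c ^ 2))ᶜ, ‖pressureForm (x - y) (mollifiedDrift η ε w s y) (w s y)‖ₑ ≤
      farConst c * ((ENNReal.ofReal c + 1) * supBallEnergy w s) :=
  lintegral_far_pressureForm_le hc
    (setLIntegral_ball_pow_drift_sq_add_sq_le hc hηc hη0 hη1 hηρ hε hερ hw hs0 hs1 hws) hx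

/-! ## The near field on a slice -/

/-- A field vanishing off the closed ball `‖y‖ ≥ R₂` has compact support. [folklore] -/
theorem hasCompactSupport_of_eq_zero {F : Type*} [Zero F] {f : ℝ³ → F} {R₂ : ℝ}
    (hf : ∀ y, R₂ ≤ ‖y‖ → f y = 0) : HasCompactSupport f :=
  HasCompactSupport.intro (isCompact_closedBall (0 : ℝ³) R₂) fun y hy => hf y (by
    rw [mem_closedBall_zero_iff, not_le] at hy; exact hy.le)

/-- The cube of a cut field is dominated by the cube of the field on the ball carrying the
cut-off. [folklore] -/
theorem lintegral_enorm_cutoff_smul_cube_le {ζ : ℝ³ → ℝ} (hζ1 : ∀ y, |ζ y| ≤ 1) {R₂ : ℝ}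
    (hζc : ∀ y, R₂ ≤ ‖y‖ → ζ y = 0) (f : ℝ³ → ℝ³) :
    ∫⁻ y, ‖ζ y • f y‖ₑ ^ (3 : ℝ) ≤ ∫⁻ y in ball (0 : ℝ³) R₂, ‖f y‖ₑ ^ (3 : ℝ) := by
  rw [← lintegral_indicator measurableSet_ball]
  refine lintegral_mono fun y => ?_
  by_cases hy : y ∈ ball (0 : ℝ³) R₂
  · rw [indicator_of_mem hy, enorm_smul]
    refine ENNReal.rpow_le_rpow (mul_le_of_le_one_left' ?_) (by norm_num)
    rw [Real.enorm_eq_ofReal_abs, ← ENNReal.ofReal_one]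
    exact ENNReal.ofReal_le_ofReal (hζ1 y)
  · rw [indicator_of_notMem hy, hζc y (not_lt.1 fun h => hy (mem_ball_zero_iff.2 h)), zero_smul,
      enorm_zero, ENNReal.zero_rpow_of_pos (by norm_num)]

/-- **The near field on a slice** (Bradshaw–Tsai 2019, p. 10: "by the Calderon-Zygmund theory,
`‖π_near(·,t)‖_{L^{3/2}(B_λ)} ≤ ‖(η_{ε√t}*v_ε)(·,t)v_ε(·,t)‖_{L^{3/2}(B_{λ²})}`, and, arguing as above
using (3.10) but with `B_{λ²}` in place of `B_λ` …"): with a smooth cut-off `ζ` (`|ζ| ≤ 1`, `ζ = 0`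
off `B_{λ³}`), `0 < s ≤ 1`, `ερ ≤ λ − 1` and a smooth slice `w(s)`,
`∫ |pvForm(ζ(η_{ε√s}*w(s)), ζw(s))|^{3/2} ≤ 2·nearConst(C) ∫_{B_{λ⁴}} |w(s)|³` (the near-field
bound of `ForwardDSSPressureKernel`, `|ζ| ≤ 1`, and (3.10) with `q = 3` from `B_{λ³}` to `B_{λ⁴}`).
[cite: BradshawTsai2019, §3 proof of Prop 3.1 (bound for π_near, p. 10)] -/
theorem lintegral_pvForm_slice_le (hc : 1 < c) (hη : ContDiff ℝ ∞ η) (hη0 : ∀ y, 0 ≤ η y)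
    (hη1 : ∫ y, η y = 1) (hηρ : ∀ y, ρ ≤ ‖y‖ → η y = 0) (hε : 0 < ε) (hερ : ε * ρ ≤ c - 1)
    {s : ℝ} (hs0 : 0 < s) (hs1 : s ≤ 1) (hws : ContDiff ℝ ∞ (w s))
    {ζ : ℝ³ → ℝ} (hζ : ContDiff ℝ ∞ ζ) (hζ1 : ∀ y, |ζ y| ≤ 1) (hζc : ∀ y, c ^ 3 ≤ ‖y‖ → ζ y = 0)
    {C : ℝ≥0} (hC : ∀ u : ℝ³ → ℝ³, ContDiff ℝ ∞ u → HasCompactSupport u →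
      eLpNorm (normalisedPressure u) (3 / 2 : ℝ≥0∞) volume ≤
        C * eLpNorm (fun x => ‖u x‖ ^ 2) (3 / 2 : ℝ≥0∞) volume) :
    ∫⁻ x, ‖pvForm (fun y => ζ y • mollifiedDrift η ε w s y) (fun y => ζ y • w s y) x‖ₑ ^ (3 / 2 : ℝ) ≤
      2 * nearConst C * ∫⁻ y in ball (0 : ℝ³) (c ^ 4), ‖w s y‖ₑ ^ (3 : ℝ) := by
  have hb : ContDiff ℝ ∞ (mollifiedDrift η ε w s) :=
    contDiff_mollifiedDrift_slice hη (hasCompactSupport_of_eq_zero hηρ)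
      (mul_pos hε (Real.sqrt_pos.2 hs0)).ne' hws.continuous.locallyIntegrable
  have hζ0 : ∀ y, c ^ 3 ≤ ‖y‖ → ζ y • mollifiedDrift η ε w s y = 0 := fun y hy => by
    rw [hζc y hy, zero_smul]
  have hζ0' : ∀ y, c ^ 3 ≤ ‖y‖ → ζ y • w s y = 0 := fun y hy => by rw [hζc y hy, zero_smul]
  have hp : ContDiff ℝ ∞ fun y => ζ y • mollifiedDrift η ε w s y := hζ.smul hb
  have hq : ContDiff ℝ ∞ fun y => ζ y • w s y := hζ.smul hws
  have key := lintegral_enorm_pvForm_rpow_le hC hp (hasCompactSupport_of_eq_zero hζ0) hq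
    (hasCompactSupport_of_eq_zero hζ0')
  refine key.trans ?_
  rw [mul_assoc, two_mul, mul_add]
  refine add_le_add (mul_le_mul' le_rfl ?_) (mul_le_mul' le_rfl ?_)
  · -- the drift: `|ζ| ≤ 1`, then (3.10) from `B_{λ³}` to `B_{λ⁴}`
    refine (lintegral_enorm_cutoff_smul_cube_le hζ1 hζc _).trans ?_
    have h := setLIntegral_ball_pow_enorm_mollifiedDrift_rpow_le (F := ℝ³) hc hη.continuous hη0 hη1
      hηρ hε hερ hs0 hs1 hws.continuous.aestronglyMeasurable (q := 3) (by norm_num) 3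
    exact h
  · refine (lintegral_enorm_cutoff_smul_cube_le hζ1 hζc _).trans (lintegral_mono_set ?_)
    exact ball_subset_ball (pow_le_pow_right₀ hc.le (by norm_num))

end Slices

/-! ## The pressure on a slice: local + near + far -/

section PressureSlice

variable {c : ℝ} {η : ℝ³ → ℝ} {ρ ε : ℝ} {w : ℝ → ℝ³ → ℝ³}

/-- The bilinear principal value of two `C^∞_c` fields is a.e.-strongly measurable. [folklore] -/
theorem aestronglyMeasurable_pvForm {p q : ℝ³ → ℝ³} (hp : ContDiff ℝ ∞ p) (hpc : HasCompactSupport p)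
    (hq : ContDiff ℝ ∞ q) (hqc : HasCompactSupport q) :
    AEStronglyMeasurable (pvForm p q) volume := by
  have h1 : AEStronglyMeasurable (diagPV (p + q)) volume :=
    (aestronglyMeasurable_normalisedPressure (hp.add hq) (hpc.add hqc)).add
      (((hp.add hq).continuous.norm.pow 2).div_const _).aestronglyMeasurable
  have h2 : AEStronglyMeasurable (diagPV (p - q)) volume :=
    (aestronglyMeasurable_normalisedPressure (hp.sub hq) (hpc.sub hqc)).add
      (((hp.sub hq).continuous.norm.pow 2).div_const _).aestronglyMeasurable
  have : pvForm p q = fun x => 4⁻¹ * (diagPV (p + q) x - diagPV (p - q) x) := rfl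
  rw [this]
  exact (h1.sub h2).const_mul _

/-- `|⟨a, b⟩|^{3/2} ≤ |a|³ + |b|³` in `ℝ≥0∞`. [folklore] -/
theorem enorm_inner_rpow_three_halves_le (a b : ℝ³) :
    ‖⟪a, b⟫‖ₑ ^ (3 / 2 : ℝ) ≤ ‖a‖ₑ ^ (3 : ℝ) + ‖b‖ₑ ^ (3 : ℝ) := by
  refine le_trans (ENNReal.rpow_le_rpow ?_ (by norm_num)) (mul_rpow_three_halves_le_add _ _)
  rw [Real.enorm_eq_ofReal_abs, ← ofReal_norm, ← ofReal_norm, ← ENNReal.ofReal_mul (norm_nonneg _)]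
  exact ENNReal.ofReal_le_ofReal (abs_real_inner_le_norm a b)

/-- **The pressure on a slice from the formula (3.8)** (Bradshaw–Tsai 2019, pp. 9–10: the local
term, `π_near`, `π_far`). Let `0 < s ≤ 1`, `ερ ≤ λ − 1`, `w` `λ`-DSS with a smooth slice `w(s)`,
`b(s) = η_{ε√s} * w(s)`, `ζ` a smooth cut-off (`|ζ| ≤ 1`, `ζ = 1` on `B_{λ²}`, `ζ = 0` off `B_{λ³}`),
and suppose the slice `ϖ(s)` is given at a.e. `x` by `ϖ(s,x) = −⅓⟨b,w⟩(s,x) + p.v.∫ΣKᵢⱼ(x−y)bᵢwⱼ`.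
Then
`∫_{B_λ}|ϖ(s)|^{3/2} ≤ 4(∫_{B_λ}|b(s)|³ + ∫_{B_λ}|w(s)|³ + 2·nearConst·∫_{B_{λ⁴}}|w(s)|³ + |B_λ|·(farConst(λ)(λ+1)α̃(s))^{3/2})`
(split the principal value with `ζ` into `pvForm(ζb, ζw)` and the far integral; the near-field
and far-field bounds of `ForwardDSSPressureKernel`; `|⟨b,w⟩|^{3/2} ≤ |b|³ + |w|³`).
[cite: BradshawTsai2019, §3 proof of Prop 3.1 (the three pressure bounds, pp. 9–10)] -/
theorem setLIntegral_ball_pressure_slice_le (hc : 1 < c) (hη : ContDiff ℝ ∞ η) (hη0 : ∀ y, 0 ≤ η y)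
    (hη1 : ∫ y, η y = 1) (hηρ : ∀ y, ρ ≤ ‖y‖ → η y = 0) (hε : 0 < ε) (hερ : ε * ρ ≤ c - 1)
    (hw : IsDiscretelySelfSimilar c w) {s : ℝ} (hs0 : 0 < s) (hs1 : s ≤ 1)
    (hws : ContDiff ℝ ∞ (w s)) {ζ : ℝ³ → ℝ} (hζ : ContDiff ℝ ∞ ζ) (hζ1 : ∀ y, |ζ y| ≤ 1)
    (hζB : ∀ y, ‖y‖ < c ^ 2 → ζ y = 1) (hζc : ∀ y, c ^ 3 ≤ ‖y‖ → ζ y = 0)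
    {C : ℝ≥0} (hC : ∀ u : ℝ³ → ℝ³, ContDiff ℝ ∞ u → HasCompactSupport u →
      eLpNorm (normalisedPressure u) (3 / 2 : ℝ≥0∞) volume ≤
        C * eLpNorm (fun x => ‖u x‖ ^ 2) (3 / 2 : ℝ≥0∞) volume)
    {ϖs : ℝ³ → ℝ}
    (hPV : ∀ᵐ x ∂(volume : Measure ℝ³), ∃ L : ℝ,
      HasPressureFormPV (mollifiedDrift η ε w s) (w s) x L ∧
        ϖs x = -(1 / 3 : ℝ) * ⟪mollifiedDrift η ε w s x, w s x⟫ + L) :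
    ∫⁻ x in ball (0 : ℝ³) c, ‖ϖs x‖ₑ ^ (3 / 2 : ℝ) ≤
      4 * ((∫⁻ x in ball (0 : ℝ³) c, ‖mollifiedDrift η ε w s x‖ₑ ^ (3 : ℝ)) +
          (∫⁻ x in ball (0 : ℝ³) c, ‖w s x‖ₑ ^ (3 : ℝ)) +
          2 * nearConst C * (∫⁻ y in ball (0 : ℝ³) (c ^ 4), ‖w s y‖ₑ ^ (3 : ℝ)) +
          volume (ball (0 : ℝ³) c) *
            (farConst c * ((ENNReal.ofReal c + 1) * supBallEnergy w s)) ^ (3 / 2 : ℝ)) := by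
  have hc0 : 0 < c := zero_lt_one.trans hc
  have hcc : c < c ^ 2 := by nlinarith
  set b : ℝ³ → ℝ³ := mollifiedDrift η ε w s with hb_def
  set p : ℝ³ → ℝ³ := fun y => ζ y • b y with hp_def
  set q : ℝ³ → ℝ³ := fun y => ζ y • w s y with hq_def
  set Fα : ℝ≥0∞ := farConst c * ((ENNReal.ofReal c + 1) * supBallEnergy w s) with hFα
  have hbC : ContDiff ℝ ∞ b := contDiff_mollifiedDrift_slice hη (hasCompactSupport_of_eq_zero hηρ)
    (mul_pos hε (Real.sqrt_pos.2 hs0)).ne' hws.continuous.locallyIntegrable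
  have hbc : Continuous b := hbC.continuous
  have hp : ContDiff ℝ ∞ p := hζ.smul hbC
  have hq : ContDiff ℝ ∞ q := hζ.smul hws
  have hpc : HasCompactSupport p :=
    hasCompactSupport_of_eq_zero (R₂ := c ^ 3) fun y hy => by simp [hp_def, hζc y hy]
  have hqc : HasCompactSupport q :=
    hasCompactSupport_of_eq_zero (R₂ := c ^ 3) fun y hy => by simp [hq_def, hζc y hy]
  have h1top : (1 : WithTop ℕ∞) ≤ ((⊤ : ℕ∞) : WithTop ℕ∞) := by exact_mod_cast le_top
  have hpE := lintegral_enorm_sq_lt_top_of_hasCompactSupport hp.continuous hpc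
  have hqE := lintegral_enorm_sq_lt_top_of_hasCompactSupport hq.continuous hqc
  -- the pointwise bound, a.e. on the ball
  have hpt : ∀ᵐ x ∂(volume.restrict (ball (0 : ℝ³) c)), ‖ϖs x‖ₑ ^ (3 / 2 : ℝ) ≤
      4 * (‖⟪b x, w s x⟫‖ₑ ^ (3 / 2 : ℝ) + ‖pvForm p q x‖ₑ ^ (3 / 2 : ℝ) + Fα ^ (3 / 2 : ℝ)) := by
    filter_upwards [ae_restrict_mem measurableSet_ball, ae_restrict_of_ae hPV] with x hx hx'
    obtain ⟨L, hL, hϖ⟩ := hx'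
    have hL' : HasPressureFormPV p q x (pvForm p q x) :=
      hasPressureFormPV_pvForm (hp.of_le h1top) (hq.of_le h1top) hpE hqE x
    obtain ⟨-, hLeq⟩ := HasPressureFormPV.eq_add_far hcc hζB (mem_ball_zero_iff.1 hx) hL hL'
    have hfar : ‖∫ y, (1 - ζ y ^ 2) * pressureForm (x - y) (b y) (w s y)‖ₑ ≤ Fα :=
      (enorm_integral_far_le hζB hζ1 x).trans
        (lintegral_far_slice_le hc hη.continuous hη0 hη1 hηρ hε hερ hw hs0 hs1 hws.continuous hx)
    have hnorm : ‖ϖs x‖ₑ ≤ ‖⟪b x, w s x⟫‖ₑ + ‖pvForm p q x‖ₑ + Fα + 0 := by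
      rw [add_zero, hϖ, hLeq]
      calc ‖-(1 / 3 : ℝ) * ⟪b x, w s x⟫ +
              (pvForm p q x + ∫ y, (1 - ζ y ^ 2) * pressureForm (x - y) (b y) (w s y))‖ₑ
          ≤ ‖-(1 / 3 : ℝ) * ⟪b x, w s x⟫‖ₑ +
              (‖pvForm p q x‖ₑ + ‖∫ y, (1 - ζ y ^ 2) * pressureForm (x - y) (b y) (w s y)‖ₑ) :=
            (enorm_add_le _ _).trans (add_le_add le_rfl (enorm_add_le _ _))
        _ ≤ ‖⟪b x, w s x⟫‖ₑ + (‖pvForm p q x‖ₑ + Fα) := by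
            refine add_le_add ?_ (add_le_add le_rfl hfar)
            rw [enorm_mul]
            refine mul_le_of_le_one_left' ?_
            rw [Real.enorm_eq_ofReal_abs, ← ENNReal.ofReal_one]
            exact ENNReal.ofReal_le_ofReal (by norm_num)
        _ = _ := by rw [add_assoc]
    calc ‖ϖs x‖ₑ ^ (3 / 2 : ℝ) ≤ (‖⟪b x, w s x⟫‖ₑ + ‖pvForm p q x‖ₑ + Fα + 0) ^ (3 / 2 : ℝ) :=
          ENNReal.rpow_le_rpow hnorm (by norm_num)
      _ ≤ 4 * (‖⟪b x, w s x⟫‖ₑ ^ (3 / 2 : ℝ) + ‖pvForm p q x‖ₑ ^ (3 / 2 : ℝ) + Fα ^ (3 / 2 : ℝ) +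
            (0 : ℝ≥0∞) ^ (3 / 2 : ℝ)) := rpow_three_halves_add_four_le _ _ _ _
      _ = _ := by rw [ENNReal.zero_rpow_of_pos (by norm_num), add_zero]
  -- measurability of the first two summands
  have hm1 : Measurable fun x => ‖⟪b x, w s x⟫‖ₑ ^ (3 / 2 : ℝ) :=
    (hbc.inner hws.continuous).enorm.measurable.pow_const _
  have hm2 : AEMeasurable (fun x => ‖pvForm p q x‖ₑ ^ (3 / 2 : ℝ)) (volume.restrict (ball (0 : ℝ³) c)) :=
    ((aestronglyMeasurable_pvForm hp hpc hq hqc).enorm.pow_const _).restrict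
  -- integrate over the ball
  calc ∫⁻ x in ball (0 : ℝ³) c, ‖ϖs x‖ₑ ^ (3 / 2 : ℝ)
      ≤ ∫⁻ x in ball (0 : ℝ³) c, 4 * (‖⟪b x, w s x⟫‖ₑ ^ (3 / 2 : ℝ) +
          ‖pvForm p q x‖ₑ ^ (3 / 2 : ℝ) + Fα ^ (3 / 2 : ℝ)) := lintegral_mono_ae hpt
    _ = 4 * ((∫⁻ x in ball (0 : ℝ³) c, ‖⟪b x, w s x⟫‖ₑ ^ (3 / 2 : ℝ)) +
          (∫⁻ x in ball (0 : ℝ³) c, ‖pvForm p q x‖ₑ ^ (3 / 2 : ℝ)) +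
          ∫⁻ _ in ball (0 : ℝ³) c, Fα ^ (3 / 2 : ℝ)) := by
        have hm12 : AEMeasurable (fun x => ‖⟪b x, w s x⟫‖ₑ ^ (3 / 2 : ℝ) +
            ‖pvForm p q x‖ₑ ^ (3 / 2 : ℝ)) (volume.restrict (ball (0 : ℝ³) c)) :=
          hm1.aemeasurable.add hm2
        rw [lintegral_const_mul' _ _ (by norm_num), lintegral_add_left' hm12,
          lintegral_add_left hm1]
    _ ≤ 4 * ((∫⁻ x in ball (0 : ℝ³) c, ‖b x‖ₑ ^ (3 : ℝ)) + (∫⁻ x in ball (0 : ℝ³) c, ‖w s x‖ₑ ^ (3 : ℝ)) +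
          2 * nearConst C * (∫⁻ y in ball (0 : ℝ³) (c ^ 4), ‖w s y‖ₑ ^ (3 : ℝ)) +
          volume (ball (0 : ℝ³) c) * Fα ^ (3 / 2 : ℝ)) := by
        refine mul_le_mul' le_rfl (add_le_add (add_le_add ?_ ?_) (le_of_eq ?_))
        · rw [← lintegral_add_left (hbc.enorm.measurable.pow_const _)]
          exact lintegral_mono fun x => enorm_inner_rpow_three_halves_le _ _
        · exact (setLIntegral_le_lintegral _ _).trans
            (lintegral_pvForm_slice_le hc hη hη0 hη1 hηρ hε hερ hs0 hs1 hws hζ hζ1 hζc hC)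
        · rw [setLIntegral_const, mul_comm]

end PressureSlice

/-! ## The pressure on `(0,t) × B_λ`: integration in time with uniform constants -/

section Main

variable {c : ℝ} {η : ℝ³ → ℝ} {ρ : ℝ}

/-- **Bradshaw–Tsai 2019, p. 10: the pressure bound for the mollified approximants, from the
formula (3.8)** ("After using Hölder's inequality, (3.11), the above bounds, and `α^{3/2} ≤ α + α³`
for `α > 0`, it is clear that `∫₀ᵗ‖π_ε(·,s)‖^{3/2}_{L^{3/2}(B_λ)} ds … ≤ C(λ,γ,η)∫₀ᵗ(α̃_ε(s)³ + α̃_ε(s))ds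
+ γ∫₀ᵗ∫|∇v_ε|²φ dx ds`"). Fix `λ > 1`, a mollifier `η ∈ C^∞` (`η ≥ 0`, `∫η = 1`, `η = 0` off `B_ρ`),
a `C¹` cut-off `χ` (`|χ| ≤ 1`, `‖Dχ‖ ≤ M`, `χ = 0` off `B_R`, `R ≤ λ`, `χ = 1` on `B₁`; `φ = χ²`), a
smooth cut-off `ζ` for the near/far splitting (`|ζ| ≤ 1`, `ζ = 1` on `B_{λ²}`, `ζ = 0` off `B_{λ³}`)
and `γ ∈ (0,∞)`. There is `C < ∞` — depending on these data only — such that for every `ε > 0`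
with `ερ ≤ λ − 1`, every `λ`-DSS field `w` continuous on the open slab with smooth slices and
continuous slice gradients, and every `ϖ` given almost everywhere on the slab by
**(3.8)** `ϖ = −⅓(η_{ε√s}*w)·w + p.v.∫ΣKᵢⱼ(·−y)(η_{ε√s}*w)ᵢ(y)wⱼ(y) dy`, one has for `0 < t ≤ 1`:
`∫∫_{(0,t)×B_λ} |ϖ|^{3/2} ≤ C∫₀ᵗ(α̃³ + α̃) + γ∫∫_{(0,t)×ℝ³}χ²|Dw|²`
(slice-wise `setLIntegral_ball_pressure_slice_le`; (3.10), (3.6) to the unit cylinder;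
Gagliardo–Nirenberg in time with a constant uniform in `w`; `α̃^{3/2} ≤ α̃ + α̃³`).
[cite: BradshawTsai2019, §3 proof of Prop 3.1 (the pressure bound, p. 10)] -/
theorem exists_setLIntegral_cylinder_pressure_rpow_le (hc : 1 < c) (hη : ContDiff ℝ ∞ η)
    (hη0 : ∀ y, 0 ≤ η y) (hη1 : ∫ y, η y = 1) (hηρ : ∀ y, ρ ≤ ‖y‖ → η y = 0)
    {χ : ℝ³ → ℝ} (hχ : ContDiff ℝ 1 χ) (hχ1 : ∀ x, |χ x| ≤ 1) {M : ℝ} (hM : ∀ x, ‖fderiv ℝ χ x‖ ≤ M)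
    {R : ℝ} (hRc : R ≤ c) (hχc : ∀ x, R ≤ ‖x‖ → χ x = 0) (hχB : ∀ x ∈ ball (0 : ℝ³) 1, χ x = 1)
    {ζ : ℝ³ → ℝ} (hζ : ContDiff ℝ ∞ ζ) (hζ1 : ∀ y, |ζ y| ≤ 1) (hζB : ∀ y, ‖y‖ < c ^ 2 → ζ y = 1)
    (hζc : ∀ y, c ^ 3 ≤ ‖y‖ → ζ y = 0) {γ : ℝ≥0∞} (hγ0 : γ ≠ 0) (hγt : γ ≠ ⊤) :
    ∃ Cp : ℝ≥0∞, Cp ≠ ⊤ ∧ ∀ (ε : ℝ) (w : ℝ → ℝ³ → ℝ³) (ϖ : ℝ → ℝ³ → ℝ), 0 < ε → ε * ρ ≤ c - 1 →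
      IsDiscretelySelfSimilar c w → ContinuousOn (uncurry w) (Ioi (0 : ℝ) ×ˢ (univ : Set ℝ³)) →
      (∀ s, 0 < s → ContDiff ℝ ∞ (w s)) →
      ContinuousOn (fun z : ℝ × ℝ³ => fderiv ℝ (w z.1) z.2) (Ioi (0 : ℝ) ×ˢ (univ : Set ℝ³)) →
      (∀ᵐ z ∂(volume.restrict (Ioi (0 : ℝ) ×ˢ (univ : Set ℝ³))), ∃ L : ℝ,
        HasPressureFormPV (mollifiedDrift η ε w z.1) (w z.1) z.2 L ∧
          ϖ z.1 z.2 = -(1 / 3 : ℝ) * ⟪mollifiedDrift η ε w z.1 z.2, w z.1 z.2⟫ + L) →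
      ∀ t : ℝ, 0 < t → t ≤ 1 →
        ∫⁻ z in Ioo (0 : ℝ) t ×ˢ ball (0 : ℝ³) c, ‖ϖ z.1 z.2‖ₑ ^ (3 / 2 : ℝ) ≤
          Cp * (∫⁻ s in Ioo (0 : ℝ) t, (supBallEnergy w s ^ 3 + supBallEnergy w s)) +
            γ * ∫⁻ z in Ioo (0 : ℝ) t ×ˢ (univ : Set ℝ³),
              ENNReal.ofReal (χ z.2 ^ 2 * frobeniusNormSq (fderiv ℝ (w z.1) z.2)) := by
  have hc0 : 0 < c := zero_lt_one.trans hc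
  -- the Calderón–Zygmund constant at `p = 3/2`
  have h32 : (1 : ℝ≥0∞) < 3 / 2 := by
    rw [ENNReal.lt_div_iff_mul_lt (Or.inl (by norm_num)) (Or.inl (by norm_num))]
    norm_num
  obtain ⟨CS, hCS⟩ := stein1970_normalisedPressure_Lp_bound_holds (3 / 2 : ℝ≥0∞) h32
    (ENNReal.div_lt_top (by norm_num) (by norm_num))
  -- the cubic-mass coefficient and the absorption weight for the Gagliardo–Nirenberg step
  set Kc : ℝ≥0∞ := 4 * (ENNReal.ofReal (c ^ 4) + ENNReal.ofReal (c ^ 2)) +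
    8 * nearConst CS * ENNReal.ofReal (c ^ 8) with hKc
  have hKc0 : Kc ≠ 0 := by
    have h4 : (0 : ℝ≥0∞) < ENNReal.ofReal (c ^ 4) := ENNReal.ofReal_pos.2 (by positivity)
    refine ne_of_gt (lt_of_lt_of_le ?_ le_self_add)
    exact ENNReal.mul_pos (by norm_num) (ne_of_gt (lt_of_lt_of_le h4 le_self_add))
  have hKct : Kc ≠ ⊤ := by
    refine ENNReal.add_ne_top.2 ⟨ENNReal.mul_ne_top (by norm_num)
      (ENNReal.add_ne_top.2 ⟨ENNReal.ofReal_ne_top, ENNReal.ofReal_ne_top⟩),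
      ENNReal.mul_ne_top (ENNReal.mul_ne_top (by norm_num) (nearConst_lt_top CS).ne)
        ENNReal.ofReal_ne_top⟩
  set γ₀ : ℝ≥0∞ := γ / Kc with hγ₀
  have hγ₀0 : γ₀ ≠ 0 := (ENNReal.div_pos_iff.2 ⟨hγ0, hKct⟩).ne'
  have hγ₀t : γ₀ ≠ ⊤ := ENNReal.div_ne_top hγt hKc0
  obtain ⟨Cγ, hCγt, hcube⟩ :=
    exists_setLIntegral_unitCylinder_cube_le hc hχ hχ1 hM hRc hχc hχB hγ₀0 hγ₀t
  -- the far-field coefficient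
  set F : ℝ≥0∞ := farConst c * (ENNReal.ofReal c + 1) with hF
  have hFt : F ≠ ⊤ :=
    ENNReal.mul_ne_top (farConst_lt_top hc).ne (ENNReal.add_ne_top.2 ⟨ENNReal.ofReal_ne_top, by norm_num⟩)
  set Kfar : ℝ≥0∞ := 4 * volume (ball (0 : ℝ³) c) * F ^ (3 / 2 : ℝ) with hKfar
  have hKfart : Kfar ≠ ⊤ :=
    ENNReal.mul_ne_top (ENNReal.mul_ne_top (by norm_num) measure_ball_lt_top.ne)
      (ENNReal.rpow_ne_top_of_nonneg (by norm_num) hFt)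
  refine ⟨Kc * Cγ + Kfar, ENNReal.add_ne_top.2 ⟨ENNReal.mul_ne_top hKct hCγt, hKfart⟩, ?_⟩
  intro ε w ϖ hε hερ hw hwm hws hHm hPV t ht0 ht1
  have hws1 : ∀ s, 0 < s → ContDiff ℝ 1 (w s) := fun s hs =>
    (hws s hs).of_le (by exact_mod_cast le_top)
  -- notation
  set I : ℝ≥0∞ := ∫⁻ s in Ioo (0 : ℝ) t, (supBallEnergy w s ^ 3 + supBallEnergy w s) with hI
  set D : ℝ≥0∞ := ∫⁻ z in Ioo (0 : ℝ) t ×ˢ (univ : Set ℝ³),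
    ENNReal.ofReal (χ z.2 ^ 2 * frobeniusNormSq (fderiv ℝ (w z.1) z.2)) with hD
  set X : ℝ → ℝ≥0∞ := fun R' => ∫⁻ z in Ioo (0 : ℝ) t ×ˢ ball (0 : ℝ³) R', ‖w z.1 z.2‖ₑ ^ (3 : ℝ)
    with hX
  -- measurability of `|w|³` on cylinders and of its slice integrals
  have hW3 : ∀ R' : ℝ, AEMeasurable (fun z : ℝ × ℝ³ => ‖w z.1 z.2‖ₑ ^ (3 : ℝ))
      (volume.restrict (Ioo (0 : ℝ) t ×ˢ ball (0 : ℝ³) R')) := fun R' =>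
    (aestronglyMeasurable_restrict_of_continuousOn hwm t measurableSet_ball).enorm.pow_const _
  have hBm : ∀ R' : ℝ, AEMeasurable (fun s => ∫⁻ x in ball (0 : ℝ³) R', ‖w s x‖ₑ ^ (3 : ℝ))
      (volume.restrict (Ioo (0 : ℝ) t)) := fun R' => by
    have h := hW3 R'
    rw [volume_restrict_real_prod] at h
    exact h.lintegral_prod_right'
  have hXeq : ∀ R' : ℝ, ∫⁻ s in Ioo (0 : ℝ) t, ∫⁻ x in ball (0 : ℝ³) R', ‖w s x‖ₑ ^ (3 : ℝ) = X R' :=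
    fun R' => (setLIntegral_cylinder_eq_iterate (hW3 R')).symm
  -- the formula slice-wise: a.e. in `s`, a.e. in `x`
  have hae : ∀ᵐ s ∂(volume.restrict (Ioo (0 : ℝ) t)), ∀ᵐ x ∂(volume : Measure ℝ³), ∃ L : ℝ,
      HasPressureFormPV (mollifiedDrift η ε w s) (w s) x L ∧
        ϖ s x = -(1 / 3 : ℝ) * ⟪mollifiedDrift η ε w s x, w s x⟫ + L := by
    have h1 : ∀ᵐ z ∂(volume.restrict (Ioo (0 : ℝ) t ×ˢ (univ : Set ℝ³))), ∃ L : ℝ,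
        HasPressureFormPV (mollifiedDrift η ε w z.1) (w z.1) z.2 L ∧
          ϖ z.1 z.2 = -(1 / 3 : ℝ) * ⟪mollifiedDrift η ε w z.1 z.2, w z.1 z.2⟫ + L :=
      ae_restrict_of_ae_restrict_of_subset (prod_mono Ioo_subset_Ioi_self Subset.rfl) hPV
    rw [volume_restrict_real_prod] at h1
    have h2 := Measure.ae_ae_of_ae_prod h1
    simpa only [Measure.restrict_univ] using h2
  -- the slice bound, integrable form
  have hslice : ∀ᵐ s ∂(volume.restrict (Ioo (0 : ℝ) t)),
      ∫⁻ x in ball (0 : ℝ³) c, ‖ϖ s x‖ₑ ^ (3 / 2 : ℝ) ≤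
        4 * (∫⁻ x in ball (0 : ℝ³) (c ^ 2), ‖w s x‖ₑ ^ (3 : ℝ)) +
          4 * (∫⁻ x in ball (0 : ℝ³) c, ‖w s x‖ₑ ^ (3 : ℝ)) +
          8 * nearConst CS * (∫⁻ x in ball (0 : ℝ³) (c ^ 4), ‖w s x‖ₑ ^ (3 : ℝ)) +
          4 * volume (ball (0 : ℝ³) c) * F ^ (3 / 2 : ℝ) * (supBallEnergy w s ^ 3 + supBallEnergy w s) := by
    filter_upwards [hae, ae_restrict_mem measurableSet_Ioo] with s hs hsI
    have hs1' : s ≤ 1 := hsI.2.le.trans ht1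
    have key := setLIntegral_ball_pressure_slice_le hc hη hη0 hη1 hηρ hε hερ hw hsI.1 hs1'
      (hws s hsI.1) hζ hζ1 hζB hζc hCS hs
    refine key.trans ?_
    -- (3.10) for the drift cube, and `(Fα̃)^{3/2} = F^{3/2} α̃^{3/2} ≤ F^{3/2}(α̃ + α̃³)`
    have hb3 : ∫⁻ x in ball (0 : ℝ³) c, ‖mollifiedDrift η ε w s x‖ₑ ^ (3 : ℝ) ≤
        ∫⁻ x in ball (0 : ℝ³) (c ^ 2), ‖w s x‖ₑ ^ (3 : ℝ) := by
      have h := setLIntegral_ball_pow_enorm_mollifiedDrift_rpow_le (F := ℝ³) hc hη.continuous hη0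
        hη1 hηρ hε hερ hsI.1 hs1' (hws s hsI.1).continuous.aestronglyMeasurable
        (q := 3) (by norm_num) 1
      rwa [pow_one] at h
    have hfar : (farConst c * ((ENNReal.ofReal c + 1) * supBallEnergy w s)) ^ (3 / 2 : ℝ) ≤
        F ^ (3 / 2 : ℝ) * (supBallEnergy w s ^ 3 + supBallEnergy w s) := by
      rw [← mul_assoc, ← hF, ENNReal.mul_rpow_of_nonneg _ _ (by norm_num)]
      refine mul_le_mul' le_rfl ?_
      rw [add_comm]
      have h := rpow_three_halves_le_self_add_pow_three (supBallEnergy w s)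
      simpa only [← ENNReal.rpow_natCast] using h
    calc 4 * ((∫⁻ x in ball (0 : ℝ³) c, ‖mollifiedDrift η ε w s x‖ₑ ^ (3 : ℝ)) +
            (∫⁻ x in ball (0 : ℝ³) c, ‖w s x‖ₑ ^ (3 : ℝ)) +
            2 * nearConst CS * (∫⁻ y in ball (0 : ℝ³) (c ^ 4), ‖w s y‖ₑ ^ (3 : ℝ)) +
            volume (ball (0 : ℝ³) c) *
              (farConst c * ((ENNReal.ofReal c + 1) * supBallEnergy w s)) ^ (3 / 2 : ℝ))
        ≤ 4 * ((∫⁻ x in ball (0 : ℝ³) (c ^ 2), ‖w s x‖ₑ ^ (3 : ℝ)) +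
            (∫⁻ x in ball (0 : ℝ³) c, ‖w s x‖ₑ ^ (3 : ℝ)) +
            2 * nearConst CS * (∫⁻ y in ball (0 : ℝ³) (c ^ 4), ‖w s y‖ₑ ^ (3 : ℝ)) +
            volume (ball (0 : ℝ³) c) * (F ^ (3 / 2 : ℝ) * (supBallEnergy w s ^ 3 + supBallEnergy w s))) := by
          gcongr
      _ = _ := by ring
  -- measurability of the integrable majorant (all four summands)
  have hmI : Measurable fun s => supBallEnergy w s ^ 3 + supBallEnergy w s :=
    ((measurable_supBallEnergy w).pow_const 3).add (measurable_supBallEnergy w)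
  have hm1 : AEMeasurable (fun s => 4 * ∫⁻ x in ball (0 : ℝ³) (c ^ 2), ‖w s x‖ₑ ^ (3 : ℝ))
      (volume.restrict (Ioo (0 : ℝ) t)) := (hBm _).const_mul _
  have hm2 : AEMeasurable (fun s => 4 * ∫⁻ x in ball (0 : ℝ³) c, ‖w s x‖ₑ ^ (3 : ℝ))
      (volume.restrict (Ioo (0 : ℝ) t)) := (hBm _).const_mul _
  have hm3 : AEMeasurable (fun s => 8 * nearConst CS * ∫⁻ x in ball (0 : ℝ³) (c ^ 4), ‖w s x‖ₑ ^ (3 : ℝ))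
      (volume.restrict (Ioo (0 : ℝ) t)) := (hBm _).const_mul _
  have hm12 : AEMeasurable (fun s => 4 * (∫⁻ x in ball (0 : ℝ³) (c ^ 2), ‖w s x‖ₑ ^ (3 : ℝ)) +
      4 * ∫⁻ x in ball (0 : ℝ³) c, ‖w s x‖ₑ ^ (3 : ℝ)) (volume.restrict (Ioo (0 : ℝ) t)) := hm1.add hm2
  have hm123 : AEMeasurable (fun s => 4 * (∫⁻ x in ball (0 : ℝ³) (c ^ 2), ‖w s x‖ₑ ^ (3 : ℝ)) +
      4 * (∫⁻ x in ball (0 : ℝ³) c, ‖w s x‖ₑ ^ (3 : ℝ)) +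
      8 * nearConst CS * ∫⁻ x in ball (0 : ℝ³) (c ^ 4), ‖w s x‖ₑ ^ (3 : ℝ))
      (volume.restrict (Ioo (0 : ℝ) t)) := hm12.add hm3
  -- the cubic masses on the unit cylinder
  have hX1 : X 1 ≤ Cγ * I + γ₀ * D := hcube w hw hws1 hHm t ht0
  have hX2 : X (c ^ 2) ≤ ENNReal.ofReal (c ^ 4) * X 1 := by
    have h := setLIntegral_cylinder_pow_enorm_cube_le hc hw 2 ht0
    simpa only [show 2 * 2 = 4 from rfl] using h
  have hXc : X c ≤ ENNReal.ofReal (c ^ 2) * X 1 := by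
    have h := setLIntegral_cylinder_pow_enorm_cube_le hc hw 1 ht0
    simpa only [pow_one, mul_one] using h
  have hX4 : X (c ^ 4) ≤ ENNReal.ofReal (c ^ 8) * X 1 := by
    have h := setLIntegral_cylinder_pow_enorm_cube_le hc hw 4 ht0
    simpa only [show 2 * 4 = 8 from rfl] using h
  -- integrate the slice bound
  calc ∫⁻ z in Ioo (0 : ℝ) t ×ˢ ball (0 : ℝ³) c, ‖ϖ z.1 z.2‖ₑ ^ (3 / 2 : ℝ)
      ≤ ∫⁻ s in Ioo (0 : ℝ) t, ∫⁻ x in ball (0 : ℝ³) c, ‖ϖ s x‖ₑ ^ (3 / 2 : ℝ) :=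
        setLIntegral_cylinder_le_iterate (fun z : ℝ × ℝ³ => ‖ϖ z.1 z.2‖ₑ ^ (3 / 2 : ℝ)) t _
    _ ≤ ∫⁻ s in Ioo (0 : ℝ) t, (4 * (∫⁻ x in ball (0 : ℝ³) (c ^ 2), ‖w s x‖ₑ ^ (3 : ℝ)) +
          4 * (∫⁻ x in ball (0 : ℝ³) c, ‖w s x‖ₑ ^ (3 : ℝ)) +
          8 * nearConst CS * (∫⁻ x in ball (0 : ℝ³) (c ^ 4), ‖w s x‖ₑ ^ (3 : ℝ)) +
          4 * volume (ball (0 : ℝ³) c) * F ^ (3 / 2 : ℝ) * (supBallEnergy w s ^ 3 + supBallEnergy w s)) :=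
        lintegral_mono_ae hslice
    _ = 4 * X (c ^ 2) + 4 * X c + 8 * nearConst CS * X (c ^ 4) + Kfar * I := by
        rw [lintegral_add_left' hm123, lintegral_add_left' hm12, lintegral_add_left' hm1,
          lintegral_const_mul'' _ (hBm _), lintegral_const_mul'' _ (hBm _),
          lintegral_const_mul'' _ (hBm _), lintegral_const_mul _ hmI, hXeq, hXeq, hXeq]
    _ ≤ 4 * (ENNReal.ofReal (c ^ 4) * X 1) + 4 * (ENNReal.ofReal (c ^ 2) * X 1) +
          8 * nearConst CS * (ENNReal.ofReal (c ^ 8) * X 1) + Kfar * I := by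
        gcongr
    _ = Kc * X 1 + Kfar * I := by rw [hKc]; ring
    _ ≤ Kc * (Cγ * I + γ₀ * D) + Kfar * I := by gcongr
    _ = (Kc * Cγ + Kfar) * I + Kc * (γ / Kc) * D := by rw [hγ₀]; ring
    _ = (Kc * Cγ + Kfar) * I + γ * D := by rw [ENNReal.mul_div_cancel hKc0 hKct]

end Main

end BradshawTsai2019

end Literature.Analysis.FluidPDE

end
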